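import Literature.AlgebraicGeometry.Hyperkaehler.LLVGeneration
import HarnessLib

/-!
# Transport of the `⟨Λ, ∪⟩`-span vocabulary of `H*(Y; R)` along a homeomorphism (PROVED, no named fact)

Layer `Literature/AlgebraicGeometry/Hyperkaehler`; companion of `LLVGeneration` (carriers
`totalCohomology R Y = ⨁ₖ Hᵏ(Y; R)`, `totalCup`, `totalPullback`, `invariantClasses`, `degreeClasses`,
`IsCupClosed`, `opCupSpan`) and of `LooijengaLuntsVerbitsky` (`degreeOperator`, `totalLefschetz`,
`IsDualLefschetz`).  Cell `hodge-kum4` (ladder HodgeAV, rung H3), tranche LT-H3, director-hodge g7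
2026-08-27T06:36:46Z item (4): the pure-algebra half of the transport input `T₄` of lane (V) — "every
`X` of `Kum⁴`-type has `H*(X(ℂ); ℂ) ≅ H*(K⁴(A)(ℂ); ℂ)` as graded `ℂ`-algebras, `Γ`-equivariantly" —
namely that EVERYTHING the cell's lemma L1 (`LefschetzGenerationKum4`:
`H*(X)^{Γ(X)} ⊆ ⟨H⁰, H², H³⟩_{(Λ, ∪)}` for every `sl(2)`-triple `(L_ℓ, h, Λ)`) is made of is
transported along the pull-back `e^*` of a homeomorphism `e : Y ≃ₜ Y'`:

* `totalPullback_comp`, `totalPullback_id`, `totalPullback_totalCup` — `f^*` is functorial and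
  multiplicative on `H*` (Hatcher Prop. 3.10, the tree's `cupProduct_map` degreewise);
* `totalPullback_apply_symm_apply` / `totalPullback_symm_apply_apply` — `e^*` and `(e⁻¹)^*` are
  mutually inverse; `degreeOperator_totalPullback` (`h ∘ f^* = f^* ∘ h`: pull-backs preserve degrees),
  `totalLefschetz_totalPullback` (`L_{f^* a} ∘ f^* = f^* ∘ L_a`);
* `isDualLefschetz_transport` — if `(L_a, h, Λ)` is an `sl(2)`-triple on `H*(Y'; R)` then
  `(L_{e^* a}, h, e^* Λ (e⁻¹)^*)` is one on `H*(Y; R)` (conjugation by an isomorphism of graded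
  algebras; Looijenga–Lunts §1: the construction `g(a, M)` is natural in the pair `(a, M)`);
* `image_degreeClasses_eq` (`e^*` maps the homogeneous classes of degrees `D` onto those of `Y`),
  `IsCupClosed.map_totalPullback`, `map_opCupSpan_eq` (`e^*⟨G⟩_{(Λ, ∪)} = ⟨e^* G⟩_{(e^*Λ(e⁻¹)^*, ∪)}`);
* `map_invariantClasses_eq` — if `e^*` INTERTWINES two families of self-maps ON COHOMOLOGY
  (`e^* ∘ f'^* = f^* ∘ e^*` for matching `f ∈ 𝓕`, `f' ∈ 𝓕'`; no relation between `e ∘ f` and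
  `f' ∘ e` as maps is asked), then `e^*(H*(Y')^{𝓕'}) = H*(Y)^{𝓕}`;
* `forall_isDualLefschetz_invariantClasses_le_opCupSpan_transport` — the L1-SHAPE statement
  "for every `sl(2)`-triple `(L_a, h, Λ)`, `H*^{𝓕} ⊆ ⟨degrees D⟩_{(Λ, ∪)}`" passes from `Y'` to `Y`
  under such an `e`.

Everything is formal (linear algebra on the direct sum); no topology beyond functoriality of
`Hᵏ(–; R)` and naturality of `⌣` is used; no named fact is introduced, no instance, no notation.
Some of the functoriality lemmas duplicate PRIVATE/Summit-side plumbing of the cell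
(`Summit.Ventures.HodgeKum4.totalPullback_totalCup`, `…totalPullback_comp_eq_mul`, seat p2) which
Literature cannot import (layering); they are re-proved here for two spaces `Y`, `Y'`.

References: A. Hatcher, *Algebraic Topology* (2002) §3.1–3.2 (induced homomorphisms; Prop. 3.10
naturality of cup product); E. Looijenga, V. Lunts, Invent. Math. 129 (1997) §1; M. Green, Y.-J. Kim,
R. Laza, C. Robles, Math. Ann. 382 (2022) §2.1–2.2.
-/

noncomputable section

open DirectSum
open Literature.AlgebraicTopology.SingularHomology
open Literature.Geometry.Kaehler

universe u v

namespace Literature.AlgebraicGeometry.Hyperkaehler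

-- No `attribute [local instance] LieRing.ofAssociativeRing` here: the commutator Lie-ring structure on
-- `gl(H*)` is baked into `IsDualLefschetz`; brackets are unfolded with `Ring.lie_def` where needed.

variable {R : Type v} [CommRing R] {Y Y' Y'' : Type u} [TopologicalSpace Y] [TopologicalSpace Y']
  [TopologicalSpace Y'']

/-! ### Functoriality and multiplicativity of `f^*` on `H*` -/

/-- `(f ∘ g)^* = g^* ∘ f^*` on the total cohomology. [cite: Hatcher2002, §3.1 "Induced homomorphisms"] -/
theorem totalPullback_comp (g : C(Y, Y')) (f : C(Y', Y'')) :
    totalPullback R (f.comp g) = totalPullback R g ∘ₗ totalPullback R f := by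
  refine linearMap_ext R fun k ↦ LinearMap.ext fun x ↦ ?_
  simp only [LinearMap.coe_comp, Function.comp_apply, totalPullback_lof, singularCohomology.map_comp,
    ModuleCat.comp_apply]

/-- `id^* = id` on the total cohomology. [cite: Hatcher2002, §3.1 "Induced homomorphisms"] -/
theorem totalPullback_id : totalPullback R (ContinuousMap.id Y) = LinearMap.id := by
  refine linearMap_ext R fun k ↦ LinearMap.ext fun x ↦ ?_
  simp only [LinearMap.coe_comp, Function.comp_apply, totalPullback_lof, singularCohomology.map_id,
    LinearMap.id_coe, id_eq]
  rfl

/-- `f^*` is multiplicative for the total cup product: `f^*(v ⌣ w) = f^* v ⌣ f^* w` (the tree's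
`cupProduct_map` degreewise). [cite: Hatcher2002, §3.2 Prop. 3.10] -/
theorem totalPullback_totalCup (f : C(Y, Y')) (v w : totalCohomology R Y') :
    totalPullback R f (totalCup R Y' v w) = totalCup R Y (totalPullback R f v) (totalPullback R f w) := by
  suffices h : (totalCup R Y').compr₂ (totalPullback R f) =
      ((totalCup R Y).comp (totalPullback R f)).compl₂ (totalPullback R f) by
    have := LinearMap.congr_fun₂ h v w
    simpa only [LinearMap.compr₂_apply, LinearMap.compl₂_apply, LinearMap.comp_apply] using this
  refine linearMap_ext R fun p ↦ LinearMap.ext fun x ↦ linearMap_ext R fun q ↦ LinearMap.ext fun y ↦ ?_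
  simp only [LinearMap.coe_comp, Function.comp_apply, LinearMap.compr₂_apply, LinearMap.compl₂_apply,
    totalCup_lof, totalPullback_lof]
  congr 1
  exact cupProduct_map f rfl x y

/-- Pull-backs preserve degrees: `h ∘ f^* = f^* ∘ h` for the degree operators of `Y` and `Y'` (same
"complex dimension" `N`). [cite: GreenKimLazaRobles2022, §2.1 (the degree operator h)] -/
theorem degreeOperator_totalPullback (f : C(Y, Y')) (N : ℕ) (w : totalCohomology R Y') :
    degreeOperator R Y N (totalPullback R f w) = totalPullback R f (degreeOperator R Y' N w) := by
  suffices h : degreeOperator R Y N ∘ₗ totalPullback R f = totalPullback R f ∘ₗ degreeOperator R Y' N from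
    LinearMap.congr_fun h w
  refine linearMap_ext R fun k ↦ LinearMap.ext fun x ↦ ?_
  simp only [LinearMap.coe_comp, Function.comp_apply, totalPullback_lof, degreeOperator_lof, map_smul]

/-- Pull-backs intertwine Lefschetz operators: `L_{f^* a} (f^* w) = f^* (L_a w)` (naturality of `⌣`).
[cite: Hatcher2002, §3.2 Prop. 3.10] [cite: LooijengaLunts1997, §1 p. 4] -/
theorem totalLefschetz_totalPullback (f : C(Y, Y')) (a : singularCohomology R R Y' 2)
    (w : totalCohomology R Y') :
    totalLefschetz (singularCohomology.map R R f 2 a) (totalPullback R f w) =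
      totalPullback R f (totalLefschetz a w) := by
  suffices h : totalLefschetz (singularCohomology.map R R f 2 a) ∘ₗ totalPullback R f =
      totalPullback R f ∘ₗ totalLefschetz a from LinearMap.congr_fun h w
  refine linearMap_ext R fun k ↦ LinearMap.ext fun x ↦ ?_
  simp only [LinearMap.coe_comp, Function.comp_apply, totalPullback_lof, totalLefschetz_lof,
    lefschetzOperator_apply]
  rw [cupProduct_map]

/-! ### Pull-back along a homeomorphism -/

section Homeomorph

variable (e : Y ≃ₜ Y')

/-- `e^* ((e⁻¹)^* v) = v`: the pull-backs along a homeomorphism and its inverse are mutually inverse.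
[cite: Hatcher2002, §3.1 (a homeomorphism induces isomorphisms)] -/
@[simp]
theorem totalPullback_apply_symm_apply (v : totalCohomology R Y) :
    totalPullback R (e : C(Y, Y')) (totalPullback R (e.symm : C(Y', Y)) v) = v := by
  rw [← LinearMap.comp_apply, ← totalPullback_comp]
  have h : (e.symm : C(Y', Y)).comp (e : C(Y, Y')) = ContinuousMap.id Y := by
    ext x; exact e.symm_apply_apply x
  rw [h, totalPullback_id, LinearMap.id_apply]

/-- `(e⁻¹)^* (e^* w) = w`. [cite: Hatcher2002, §3.1 (a homeomorphism induces isomorphisms)] -/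
@[simp]
theorem totalPullback_symm_apply_apply (w : totalCohomology R Y') :
    totalPullback R (e.symm : C(Y', Y)) (totalPullback R (e : C(Y, Y')) w) = w := by
  rw [← LinearMap.comp_apply, ← totalPullback_comp]
  have h : (e : C(Y, Y')).comp (e.symm : C(Y', Y)) = ContinuousMap.id Y' := by
    ext x; exact e.apply_symm_apply x
  rw [h, totalPullback_id, LinearMap.id_apply]

/-- `e^*` is injective. [cite: Hatcher2002, §3.1] -/
theorem totalPullback_homeomorph_injective : Function.Injective (totalPullback R (e : C(Y, Y'))) := by
  intro v w hvw
  have h := congrArg (totalPullback R (e.symm : C(Y', Y))) hvw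
  simpa only [totalPullback_symm_apply_apply] using h

/-- `e^*` is surjective. [cite: Hatcher2002, §3.1] -/
theorem totalPullback_homeomorph_surjective : Function.Surjective (totalPullback R (e : C(Y, Y'))) :=
  fun v ↦ ⟨totalPullback R (e.symm : C(Y', Y)) v, totalPullback_apply_symm_apply e v⟩

/-! ### Transport of `sl(2)`-triples `(L_a, h, Λ)` -/

/-- The conjugate `e^* ∘ Λ ∘ (e⁻¹)^*` of an operator on `H*(Y'; R)` — an operator on `H*(Y; R)`
(plumbing abbreviation used only inside this file's statements, spelled out). Conjugation is
multiplicative. [cite: LooijengaLunts1997, §1 p. 4] -/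
theorem conj_totalPullback_mul (A B : Module.End R (totalCohomology R Y')) :
    totalPullback R (e : C(Y, Y')) ∘ₗ (A * B) ∘ₗ totalPullback R (e.symm : C(Y', Y)) =
      (totalPullback R (e : C(Y, Y')) ∘ₗ A ∘ₗ totalPullback R (e.symm : C(Y', Y))) *
        (totalPullback R (e : C(Y, Y')) ∘ₗ B ∘ₗ totalPullback R (e.symm : C(Y', Y))) := by
  refine LinearMap.ext fun v ↦ ?_
  simp only [LinearMap.coe_comp, Function.comp_apply, Module.End.mul_apply,
    totalPullback_symm_apply_apply]

/-- Conjugation is compatible with subtraction. [cite: LooijengaLunts1997, §1 p. 4] -/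
theorem conj_totalPullback_sub (A B : Module.End R (totalCohomology R Y')) :
    totalPullback R (e : C(Y, Y')) ∘ₗ (A - B) ∘ₗ totalPullback R (e.symm : C(Y', Y)) =
      totalPullback R (e : C(Y, Y')) ∘ₗ A ∘ₗ totalPullback R (e.symm : C(Y', Y)) -
        totalPullback R (e : C(Y, Y')) ∘ₗ B ∘ₗ totalPullback R (e.symm : C(Y', Y)) := by
  rw [LinearMap.sub_comp, LinearMap.comp_sub]

/-- The conjugate of the degree operator of `Y'` is the degree operator of `Y`.
[cite: GreenKimLazaRobles2022, §2.1 (the degree operator h)] -/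
theorem conj_totalPullback_degreeOperator (N : ℕ) :
    totalPullback R (e : C(Y, Y')) ∘ₗ degreeOperator R Y' N ∘ₗ totalPullback R (e.symm : C(Y', Y)) =
      degreeOperator R Y N := by
  refine LinearMap.ext fun v ↦ ?_
  simp only [LinearMap.coe_comp, Function.comp_apply]
  rw [← degreeOperator_totalPullback, totalPullback_apply_symm_apply]

/-- The conjugate of `L_a` is `L_{e^* a}`. [cite: LooijengaLunts1997, §1 p. 4] -/
theorem conj_totalPullback_totalLefschetz (a : singularCohomology R R Y' 2) :
    totalPullback R (e : C(Y, Y')) ∘ₗ totalLefschetz a ∘ₗ totalPullback R (e.symm : C(Y', Y)) =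
      totalLefschetz (singularCohomology.map R R (e : C(Y, Y')) 2 a) := by
  refine LinearMap.ext fun v ↦ ?_
  simp only [LinearMap.coe_comp, Function.comp_apply]
  rw [← totalLefschetz_totalPullback, totalPullback_apply_symm_apply]

/-- Conjugation reflects `0`: if `e^* A (e⁻¹)^* = 0` then `A = 0`. [cite: LooijengaLunts1997, §1 p. 4] -/
theorem eq_zero_of_conj_totalPullback_eq_zero {A : Module.End R (totalCohomology R Y')}
    (h : totalPullback R (e : C(Y, Y')) ∘ₗ A ∘ₗ totalPullback R (e.symm : C(Y', Y)) = 0) : A = 0 := by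
  refine LinearMap.ext fun w ↦ ?_
  have hw := LinearMap.congr_fun h (totalPullback R (e : C(Y, Y')) w)
  simp only [LinearMap.coe_comp, Function.comp_apply, totalPullback_symm_apply_apply,
    LinearMap.zero_apply] at hw
  have := congrArg (totalPullback R (e.symm : C(Y', Y))) hw
  simpa only [totalPullback_symm_apply_apply, map_zero, LinearMap.zero_apply] using this

/-- **`sl(2)`-triples are transported along a homeomorphism.**  If `Λ` is a dual Lefschetz operator of
`a ∈ H²(Y'; R)` (in "complex dimension" `N`), then `e^* ∘ Λ ∘ (e⁻¹)^*` is a dual Lefschetz operator of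
`e^* a ∈ H²(Y; R)`: conjugation by the graded-algebra isomorphism `e^*` carries `h` to `h`, `L_a` to
`L_{e^* a}` and preserves brackets. [cite: LooijengaLunts1997, §1 p. 4] [cite: GreenKimLazaRobles2022, §2.1] -/
theorem isDualLefschetz_transport {N : ℕ} {a : singularCohomology R R Y' 2}
    {Λ : Module.End R (totalCohomology R Y')} (hΛ : IsDualLefschetz N a Λ) :
    IsDualLefschetz N (singularCohomology.map R R (e : C(Y, Y')) 2 a)
      (totalPullback R (e : C(Y, Y')) ∘ₗ Λ ∘ₗ totalPullback R (e.symm : C(Y', Y))) := by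
  -- destructure the `sl(2)`-relations on `Y'` (no Lie-ring instance is synthesised: the fields carry it)
  obtain ⟨hne, hef, -, hhf⟩ := hΛ
  rw [Ring.lie_def] at hef hhf
  refine (isDualLefschetz_iff N _ _).2 ⟨?_, ?_, ?_⟩
  · -- `h ≠ 0` on `Y`: its conjugate back to `Y'` is the `h` of `Y'`, which is `≠ 0`
    intro h0
    apply hne
    apply eq_zero_of_conj_totalPullback_eq_zero e
    rw [conj_totalPullback_degreeOperator, h0]
  · rw [Ring.lie_def, ← conj_totalPullback_totalLefschetz, ← conj_totalPullback_mul,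
      ← conj_totalPullback_mul, ← conj_totalPullback_sub, hef, conj_totalPullback_degreeOperator]
  · have h4 : totalPullback R (e : C(Y, Y')) ∘ₗ (-(2 • Λ)) ∘ₗ totalPullback R (e.symm : C(Y', Y)) =
        -(2 • (totalPullback R (e : C(Y, Y')) ∘ₗ Λ ∘ₗ totalPullback R (e.symm : C(Y', Y)))) := by
      refine LinearMap.ext fun v ↦ ?_
      simp only [two_nsmul, LinearMap.coe_comp, Function.comp_apply, LinearMap.neg_apply,
        LinearMap.add_apply, map_neg, map_add]
    rw [Ring.lie_def, ← conj_totalPullback_degreeOperator e N, ← conj_totalPullback_mul,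
      ← conj_totalPullback_mul, ← conj_totalPullback_sub, hhf, h4]

/-! ### Transport of generating sets and spans -/

/-- `e^*` maps the homogeneous classes of degrees `D` of `Y'` ONTO those of `Y`.
[cite: GreenKimLazaRobles2022, §2.2] -/
theorem image_degreeClasses_eq (D : Set ℕ) :
    totalPullback R (e : C(Y, Y')) '' degreeClasses R Y' D = degreeClasses R Y D := by
  apply Set.Subset.antisymm
  · rintro _ ⟨v, hv, rfl⟩
    simp only [degreeClasses, Set.mem_iUnion, Set.mem_range] at hv ⊢
    obtain ⟨k, hk, x, rfl⟩ := hv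
    exact ⟨k, hk, singularCohomology.map R R (e : C(Y, Y')) k x, (totalPullback_lof _ k x).symm⟩
  · intro v hv
    simp only [degreeClasses, Set.mem_iUnion, Set.mem_range] at hv
    obtain ⟨k, hk, x, rfl⟩ := hv
    refine ⟨ofDegree R Y' k (singularCohomology.map R R (e.symm : C(Y', Y)) k x),
      ofDegree_mem_degreeClasses hk _, ?_⟩
    rw [← totalPullback_lof, totalPullback_apply_symm_apply]

/-- The image under `e^*` of a cup-closed submodule is cup-closed. [cite: Hatcher2002, §3.2 Prop. 3.10] -/
theorem IsCupClosed.map_totalPullback {S : Submodule R (totalCohomology R Y')} (hS : IsCupClosed S) :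
    IsCupClosed (S.map (totalPullback R (e : C(Y, Y')))) := by
  rintro _ ⟨x, hx, rfl⟩ _ ⟨y, hy, rfl⟩
  exact ⟨totalCup R Y' x y, hS x hx y hy, totalPullback_totalCup _ x y⟩

/-- **`e^*` transports `⟨Λ, ∪⟩`-spans**: the image under `e^*` of the `⟨Λ, ∪⟩`-span of `G ⊆ H*(Y'; R)`
is the `⟨e^*Λ(e⁻¹)^*, ∪⟩`-span of `e^* G ⊆ H*(Y; R)`. [cite: LooijengaLunts1997, §1 p. 4 and (1.9)] -/
theorem map_opCupSpan_eq (Λ : Module.End R (totalCohomology R Y')) (G : Set (totalCohomology R Y')) :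
    (opCupSpan R Y' Λ G).map (totalPullback R (e : C(Y, Y'))) =
      opCupSpan R Y (totalPullback R (e : C(Y, Y')) ∘ₗ Λ ∘ₗ totalPullback R (e.symm : C(Y', Y)))
        (totalPullback R (e : C(Y, Y')) '' G) := by
  apply le_antisymm
  · -- `⟨G⟩ ≤ comap e^* (RHS)`, by minimality of `⟨G⟩`
    rw [Submodule.map_le_iff_le_comap]
    refine opCupSpan_le ?_ ?_ ?_
    · intro v hv
      exact subset_opCupSpan (Set.mem_image_of_mem _ hv)
    · intro x hx y hy
      simp only [Submodule.mem_comap] at hx hy ⊢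
      rw [totalPullback_totalCup]
      exact isCupClosed_opCupSpan _ hx _ hy
    · intro v hv
      simp only [Submodule.mem_comap] at hv ⊢
      have h := mem_stabilizerLie_opCupSpan
        (Λ := totalPullback R (e : C(Y, Y')) ∘ₗ Λ ∘ₗ totalPullback R (e.symm : C(Y', Y)))
        (G := totalPullback R (e : C(Y, Y')) '' G) (R := R) (Y := Y) _ hv
      simpa only [LinearMap.coe_comp, Function.comp_apply, totalPullback_symm_apply_apply] using h
  · refine opCupSpan_le ?_ (isCupClosed_opCupSpan.map_totalPullback e) ?_
    · rintro _ ⟨v, hv, rfl⟩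
      exact ⟨v, subset_opCupSpan hv, rfl⟩
    · rintro _ ⟨w, hw, rfl⟩
      refine ⟨Λ w, mem_stabilizerLie_opCupSpan w hw, ?_⟩
      simp only [LinearMap.coe_comp, Function.comp_apply, totalPullback_symm_apply_apply]

/-! ### Transport of invariant classes under cohomological intertwining -/

/-- **`e^*` carries invariants to invariants** when it intertwines two families of self-maps ON
COHOMOLOGY: if for every `f' ∈ 𝓕'` there is `f ∈ 𝓕` with `e^* ∘ f'^* = f^* ∘ e^*` and for every
`f ∈ 𝓕` there is such an `f' ∈ 𝓕'`, then `e^*(H*(Y'; R)^{𝓕'}) = H*(Y; R)^{𝓕}`.  (Only the induced maps on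
cohomology are compared; `e` need not conjugate the self-maps.)
[cite: Floccari2023, §2.4–2.5 (invariants of Aut₀)] [cite: Hatcher2002, §3.1] -/
theorem map_invariantClasses_eq {𝓕 : Set C(Y, Y)} {𝓕' : Set C(Y', Y')}
    (h₁ : ∀ f' ∈ 𝓕', ∃ f ∈ 𝓕, totalPullback R (e : C(Y, Y')) ∘ₗ totalPullback R f' =
      totalPullback R f ∘ₗ totalPullback R (e : C(Y, Y')))
    (h₂ : ∀ f ∈ 𝓕, ∃ f' ∈ 𝓕', totalPullback R (e : C(Y, Y')) ∘ₗ totalPullback R f' =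
      totalPullback R f ∘ₗ totalPullback R (e : C(Y, Y'))) :
    (invariantClasses R 𝓕').map (totalPullback R (e : C(Y, Y'))) = invariantClasses R 𝓕 := by
  apply le_antisymm
  · rintro _ ⟨w, hw, rfl⟩
    rw [SetLike.mem_coe, mem_invariantClasses_iff] at hw
    rw [mem_invariantClasses_iff]
    intro f hf
    obtain ⟨f', hf', hff'⟩ := h₂ f hf
    have := LinearMap.congr_fun hff' w
    simp only [LinearMap.coe_comp, Function.comp_apply] at this
    rw [← this, hw f' hf']
  · intro v hv
    refine ⟨totalPullback R (e.symm : C(Y', Y)) v, ?_, totalPullback_apply_symm_apply e v⟩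
    rw [mem_invariantClasses_iff] at hv
    rw [SetLike.mem_coe, mem_invariantClasses_iff]
    intro f' hf'
    obtain ⟨f, hf, hff'⟩ := h₁ f' hf'
    apply totalPullback_homeomorph_injective e
    have := LinearMap.congr_fun hff' (totalPullback R (e.symm : C(Y', Y)) v)
    simp only [LinearMap.coe_comp, Function.comp_apply, totalPullback_apply_symm_apply] at this
    rw [this, hv f hf, totalPullback_apply_symm_apply]

/-- **Transport of the L1-shape statement.**  Under the cohomological intertwining of `𝓕` (on `Y`)
with `𝓕'` (on `Y'`) along `e`, if for EVERY `sl(2)`-triple `(L_a, h, Λ)` on `H*(Y'; R)` the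
`𝓕'`-invariant classes lie in the `⟨Λ, ∪⟩`-span of the homogeneous classes of degrees `D`, then the same
holds on `Y` for every `sl(2)`-triple there: transport the triple to `Y'` along `e⁻¹`
(`isDualLefschetz_transport`), apply the hypothesis, and map back with `map_invariantClasses_eq`,
`map_opCupSpan_eq`, `image_degreeClasses_eq`. (For `Y = X(ℂ)`, `Y' = K⁴(A)(ℂ)`, `𝓕 = Γ(X)`,
`D = {0, 2, 3}`: the cell's L1 passes from the generalized Kummer varieties to every `X` of
`Kum⁴`-type.) [cite: LooijengaLunts1997, §1 p. 4 and (1.9)] [cite: GreenKimLazaRobles2022, §2.2] -/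
theorem forall_isDualLefschetz_invariantClasses_le_opCupSpan_transport {N : ℕ} {D : Set ℕ}
    {𝓕 : Set C(Y, Y)} {𝓕' : Set C(Y', Y')}
    (h₁ : ∀ f' ∈ 𝓕', ∃ f ∈ 𝓕, totalPullback R (e : C(Y, Y')) ∘ₗ totalPullback R f' =
      totalPullback R f ∘ₗ totalPullback R (e : C(Y, Y')))
    (h₂ : ∀ f ∈ 𝓕, ∃ f' ∈ 𝓕', totalPullback R (e : C(Y, Y')) ∘ₗ totalPullback R f' =
      totalPullback R f ∘ₗ totalPullback R (e : C(Y, Y')))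
    (hY' : ∀ (a : singularCohomology R R Y' 2) (Λ : Module.End R (totalCohomology R Y')),
      IsDualLefschetz N a Λ → invariantClasses R 𝓕' ≤ opCupSpan R Y' Λ (degreeClasses R Y' D))
    (a : singularCohomology R R Y 2) (Λ : Module.End R (totalCohomology R Y)) (hΛ : IsDualLefschetz N a Λ) :
    invariantClasses R 𝓕 ≤ opCupSpan R Y Λ (degreeClasses R Y D) := by
  -- transport `(a, Λ)` to `Y'` along `e⁻¹`
  have hΛ' := isDualLefschetz_transport e.symm hΛ
  have key := hY' _ _ hΛ'
  -- map back along `e`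
  have hconj : totalPullback R (e : C(Y, Y')) ∘ₗ
      (totalPullback R (e.symm : C(Y', Y)) ∘ₗ Λ ∘ₗ totalPullback R (e.symm.symm : C(Y, Y'))) ∘ₗ
        totalPullback R (e.symm : C(Y', Y)) = Λ := by
    refine LinearMap.ext fun v ↦ ?_
    simp only [Homeomorph.symm_symm, LinearMap.coe_comp, Function.comp_apply,
      totalPullback_apply_symm_apply]
  rw [← map_invariantClasses_eq e h₁ h₂, ← hconj, ← image_degreeClasses_eq e D, ← map_opCupSpan_eq]
  exact Submodule.map_mono key

end Homeomorph

end Literature.AlgebraicGeometry.Hyperkaehler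

end
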